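import Summits.BirchSwinnertonDyer.Rank1Residual.X11b.RouteR1IntReceptacle
import HarnessLib

/-!
# X11b — the ONE-SIDED algebra over the wide receptacle `𝓞_{ℂ_p}⟦T⟧` (every `p`): divisibility
# `Ch_Λ(X_ac)·𝓞_{ℂ_p}⟦T⟧ ⊆ (Q)` and a value shape `Q(𝟙) = u·((1 − a/p)·log_ω P)²` with `‖u‖ ≤ 1` give
# S0's binder `IMCLowerWaldspurgerOnTreeAt` — no `R₀`, no unit, no noetherianity

HONEST FRAMING (cell `b2b-bsdres`, run/shared/lean/b2b/bsd-rank1-residual/, verbatim in every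
file): the goal of the cell is to DELETE the COMBINATION-SHAPED residual classes of the
Birch–Swinnerton-Dyer formula for ALL analytic-rank `≤ 1` elliptic curves over `ℚ` — "full BSD
formula for every rank `≤ 1` curve in class `C`" assembled STRICTLY from published theorems — so
that the rank-`≤ 1` remainder becomes exactly the CONSTRUCTION-SHAPED classes, which are TYPED
(missing-input `Prop`s), NOT attempted. This is not "finishing BSD". Sub-cell
`b2b-bsdres-multr1-p1` (X11b, route R1, gen 23); THEOREMS ONLY (no definition, no named fact, no
`sorry`); every-`p` infrastructure offered to the one-sided routes (multr1-p2's route p2 at `p ≥ 5`,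
lit-cw's X6 halves, x11b3's halves at `3`) — nothing of theirs is imported, restated or re-typed here
(treaty A6.3 (2): `X11b.R1.` names).

## What this file proves (gen 23, companion of `RouteR1IntReceptacle.lean`)

The EQUALITY algebra of `RouteR1IntReceptacle.lean` (`R1.valuation_constantCoeff_eq_of_span_map_eq_int`)
serves route R1 (erratum Thm. 1.1 is an equality). The one-sided routes consume only the printed
DIVISIBILITY (2.4) "`Ch_Λ(X_ac)·Λ_{R₀} ⊆ (L_p(f))`" and an INEQUALITY on `ord_p`. Over Hsieh's
receptacle `𝓞_{ℂ_p}⟦T⟧` the same norm argument gives (x11b3's `Halves.two_mul_sub_one_le_valuation`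
and `Halves.imcLowerWaldspurgerOnTreeAt_of_value_of_dvd` with `R₀` replaced by `𝓞_{ℂ_p}`, and the unit
`u ∈ R₀ˣ` replaced by ANY `u` with `‖u‖ ≤ 1` — for an upper bound on `‖f(0)‖` the unit is not needed):

* `R1.two_mul_sub_one_le_valuation_int`: `f ∈ Λ`, `f(0) ≠ 0`, `f ↦ (Q)` in `𝓞_{ℂ_p}⟦T⟧`,
  `Q(0) = u·((1 − a p⁻¹)·x)²`, `‖u‖ ≤ 1` ⟹ `x ≠ 0 ∧ 2·(ord_p x − 1) ≤ ord_p f(0)`;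
* `R1.imcLowerWaldspurgerOnTreeAt_of_intValue_of_intDvd`: CTL₀ ∧ (2.4)♭ ∧ value♭ ⟹
  `IMCLowerWaldspurgerOnTreeAt p κ 𝔭 γ ι P` (S0's binder) with the SAME `n`;
* the transfers `R₀ → 𝓞_{ℂ_p}` of the one-sided hypotheses (`R1.map_mem_span_map_of_mem_span`,
  `R1.ideal_map_le_span_map_of_le`): a divisibility over `R₀⟦T⟧` implies the one over `𝓞_{ℂ_p}⟦T⟧`
  for the same element, so a ♭-typed one-sided input is WEAKER than an `R₀`-typed one.

So a refereed (or announced) one-sided divisibility for the BDP element typed over ANY coefficient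
ring inside `𝓞_{ℂ_p}` — `R₀`, a finite extension `𝒲`, Hsieh's `Z̄_p`, `𝓞_{ℂ_p}` — feeds S0's binder.
Nothing is asserted; no label change.

References: [Castella2018] §5 (5.1)–(5.3) (arXiv:1704.06608 p. 12); [Castella2018Erratum] (2.4)
(p. 1); [Hsieh2014] p. 7 (`Λ = Z̄_p⟦Γ⁻⟧`).
-/

noncomputable section

open scoped Classical

open WeierstrassCurve NumberField IsDedekindDomain Field PowerSeries
open Literature.NumberTheory.EllipticCurves
open Literature.NumberTheory.EllipticCurves.Rank1Residual
open Literature.NumberTheory.GaloisRepresentations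
open Summit.BirchSwinnertonDyer.Rank1Residual.X11b.AcSelmer
open Summit.BirchSwinnertonDyer.Rank1Residual.X11b.CongruenceLimit
open Summit.BirchSwinnertonDyer.Rank1Residual.X11b.Halves

namespace Summit.BirchSwinnertonDyer.Rank1Residual.X11b

/-! ### §1 The one-sided algebra over `𝓞_{ℂ_p}⟦T⟧` (every prime `p`, every integer `a`) -/

section Algebra

variable (p : ℕ) [Fact p.Prime]

/-- **The algebra of HALVES over the wide receptacle.** If `f ∈ Λ = ℤ_p⟦T⟧` has non-zero constant
term, its image in `𝓞_{ℂ_p}⟦T⟧` lies in `(Q)` (the divisibility), and `Q(0) = u·((1 − a p⁻¹)·x)²` with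
`‖u‖ ≤ 1` (a value SHAPE — `u` need not be a unit for this direction), then `x ≠ 0` and
`2·(ord_p x − 1) ≤ ord_p f(0)`. Norms in `ℂ_p`: `‖f(0)‖ = ‖G(0)‖·‖Q(0)‖ ≤ ‖Q(0)‖ ≤ ‖(1 − a/p)x‖² ≤
p²‖x‖²`. [folklore] -/
theorem R1.two_mul_sub_one_le_valuation_int {f : IwasawaAlgebra p} (hf0 : constantCoeff f ≠ 0)
    {Q : PowerSeries 𝓞_ℂ_[p]} (hfQ : PowerSeries.map (R1.toCpInt p) f ∈ Ideal.span {Q})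
    {u : ℂ_[p]} (hu : ‖u‖ ≤ 1) (a : ℤ) {x : ℚ_[p]}
    (hQ : IntSeries.HasValueAt Q 0 (u *
      (algebraMap ℚ_[p] ℂ_[p] (((1 : ℚ_[p]) - (a : ℚ_[p]) * (p : ℚ_[p])⁻¹) * x)) ^ 2)) :
    x ≠ 0 ∧ 2 * (x.valuation - 1) ≤ ((constantCoeff f).valuation : ℤ) := by
  set y : ℚ_[p] := ((1 : ℚ_[p]) - (a : ℚ_[p]) * (p : ℚ_[p])⁻¹) * x with hy
  -- `Q(0)` is the constant term
  have hQ0 : u * (algebraMap ℚ_[p] ℂ_[p] y) ^ 2 = ((constantCoeff Q : 𝓞_ℂ_[p]) : ℂ_[p]) :=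
    R1.intSeries_eq_constantCoeff_of_hasValueAt_zero p hQ
  -- `f ↦ G·Q`
  obtain ⟨G, hG⟩ := Ideal.mem_span_singleton'.mp hfQ
  have hfac : algebraMap ℚ_[p] ℂ_[p] ((constantCoeff f : ℤ_[p]) : ℚ_[p]) =
      ((constantCoeff G : 𝓞_ℂ_[p]) : ℂ_[p]) * ((constantCoeff Q : 𝓞_ℂ_[p]) : ℂ_[p]) := by
    rw [← R1.coe_toCpInt, ← constantCoeff_map_apply (R1.toCpInt p) f, ← hG, map_mul,
      MulMemClass.coe_mul]
  -- norms
  have hp1 : (1 : ℝ) < p := by exact_mod_cast (Fact.out : p.Prime).one_lt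
  have hp0 : (0 : ℝ) < p := by positivity
  have hnormf : ‖((constantCoeff f : ℤ_[p]) : ℚ_[p])‖ ≤ (p : ℝ) ^ 2 * ‖x‖ ^ 2 := by
    calc ‖((constantCoeff f : ℤ_[p]) : ℚ_[p])‖
        = ‖algebraMap ℚ_[p] ℂ_[p] ((constantCoeff f : ℤ_[p]) : ℚ_[p])‖ :=
          (norm_algebraMap' ℂ_[p] _).symm
      _ = ‖((constantCoeff G : 𝓞_ℂ_[p]) : ℂ_[p])‖ *
            ‖((constantCoeff Q : 𝓞_ℂ_[p]) : ℂ_[p])‖ := by rw [hfac, norm_mul]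
      _ ≤ 1 * ‖((constantCoeff Q : 𝓞_ℂ_[p]) : ℂ_[p])‖ :=
          mul_le_mul_of_nonneg_right (R1.norm_coe_padicComplexInt_le_one p _) (norm_nonneg _)
      _ = ‖u‖ * ‖algebraMap ℚ_[p] ℂ_[p] y‖ ^ 2 := by
          rw [one_mul, ← hQ0, norm_mul, norm_pow]
      _ ≤ 1 * ‖algebraMap ℚ_[p] ℂ_[p] y‖ ^ 2 :=
          mul_le_mul_of_nonneg_right hu (pow_nonneg (norm_nonneg _) 2)
      _ = ‖y‖ ^ 2 := by rw [one_mul, norm_algebraMap']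
      _ ≤ ((p : ℝ) * ‖x‖) ^ 2 := by
          refine pow_le_pow_left₀ (norm_nonneg _) ?_ 2
          rw [hy, norm_mul]
          exact mul_le_mul_of_nonneg_right (norm_one_sub_div_le p a) (norm_nonneg _)
      _ = (p : ℝ) ^ 2 * ‖x‖ ^ 2 := by ring
  -- `x ≠ 0`
  have hx0 : x ≠ 0 := by
    intro hx
    rw [hx, norm_zero, zero_pow two_ne_zero, mul_zero] at hnormf
    have h0 : ((constantCoeff f : ℤ_[p]) : ℚ_[p]) = 0 :=
      norm_eq_zero.mp (le_antisymm hnormf (norm_nonneg _))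
    exact hf0 (PadicInt.coe_eq_zero.mp h0)
  refine ⟨hx0, two_mul_sub_one_le_of_zpow_le p ?_⟩
  rwa [← PadicInt.norm_def, PadicInt.norm_eq_zpow_neg_valuation hf0,
    Padic.norm_eq_zpow_neg_valuation hx0] at hnormf

/-- **Transfer of the divisibility hypothesis along `R₀ ⊆ 𝓞_{ℂ_p}`** (membership form): if the image of
`f ∈ Λ` in `R₀⟦T⟧` lies in `(L)`, its image in `𝓞_{ℂ_p}⟦T⟧` lies in `(L)` read there. [folklore] -/
theorem R1.map_mem_span_map_of_mem_span {f : IwasawaAlgebra p} {L : UnrSeries p}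
    (h : PowerSeries.map (toUnr p) f ∈ Ideal.span {L}) :
    PowerSeries.map (R1.toCpInt p) f ∈
      Ideal.span ({PowerSeries.map (R1.unrToCpInt p) L} : Set (PowerSeries 𝓞_ℂ_[p])) := by
  obtain ⟨G, hG⟩ := Ideal.mem_span_singleton'.mp h
  rw [← R1.map_unrToCpInt_map_toUnr, ← hG, map_mul]
  exact Ideal.mul_mem_left _ _ (Ideal.mem_span_singleton_self _)

/-- **Transfer of the divisibility hypothesis along `R₀ ⊆ 𝓞_{ℂ_p}`** (ideal form, as the one-sided
routes type it: `I·R₀⟦T⟧ ⊆ (L)` ⟹ `I·𝓞_{ℂ_p}⟦T⟧ ⊆ (L)`). [folklore] -/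
theorem R1.ideal_map_le_span_map_of_le {I : Ideal (IwasawaAlgebra p)} {L : UnrSeries p}
    (h : I.map (PowerSeries.map (toUnr p)) ≤ Ideal.span {L}) :
    I.map (PowerSeries.map (R1.toCpInt p)) ≤
      Ideal.span ({PowerSeries.map (R1.unrToCpInt p) L} : Set (PowerSeries 𝓞_ℂ_[p])) := by
  rw [R1.map_toCpInt_eq_comp, ← Ideal.map_map]
  refine (Ideal.map_mono h).trans ?_
  rw [Ideal.map_span, Set.image_singleton]

end Algebra

/-! ### §2 Pointwise: the one-sided halves over `𝓞_{ℂ_p}⟦T⟧` give S0's binder (every `p`) -/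

section Pointwise

variable {K : Type} [Field K] [NumberField K] (W : WeierstrassCurve ℚ) [W.IsElliptic]
  [W.IsGloballyMinimal] (p : ℕ) [Fact p.Prime] (ι : K →+* ℚ_[p])
  (P : (W.baseChange K).toAffine.Point)

variable (κ : ZpExtension K p) (𝔭 : HeightOneSpectrum (𝓞 K)) (γ : Field.absoluteGaloisGroup K)
  [Fact (κ.IsTopGenerator γ)]

variable {W p ι P κ 𝔭 γ} in
/-- **ONE-SIDED HALVES OVER THE WIDE RECEPTACLE ⟹ S0's binder, pointwise (every `p`).** CTL₀
(`HasCharValuationAt … n`) ∧ (2.4)♭ (`Ch_Λ(X_ac)·𝓞_{ℂ_p}⟦T⟧ ⊆ (Q)`) ∧ value♭ (`Q(𝟙) = u·((1 − a/p)·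
log_{ω_E} P)²`, `‖u‖ ≤ 1`) ⟹ `IMCLowerWaldspurgerOnTreeAt p κ 𝔭 γ ι P` with the SAME `n`; `log_{ω_E} P ≠ 0`
comes out, it is not put in. x11b3's `Halves.imcLowerWaldspurgerOnTreeAt_of_value_of_dvd` with `R₀`
replaced by `𝓞_{ℂ_p}` and the unit by any `‖u‖ ≤ 1`.
[cite: Castella2018, §5 (5.1)–(5.3) (arXiv:1704.06608 p. 12) (the assembly, as an inequality)] -/
theorem R1.imcLowerWaldspurgerOnTreeAt_of_intValue_of_intDvd {n : ℕ}
    (hn : XAc.HasCharValuationAt (W.baseChange K) p κ 𝔭 ∅ γ n) {Q : PowerSeries 𝓞_ℂ_[p]}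
    (h3 : (XAc.charIdeal (W.baseChange K) p κ 𝔭 ∅ γ).map (PowerSeries.map (R1.toCpInt p)) ≤
      Ideal.span {Q})
    {u : ℂ_[p]} (hu : ‖u‖ ≤ 1) (a : ℤ)
    (h2 : IntSeries.HasValueAt Q 0 (u *
      (algebraMap ℚ_[p] ℂ_[p] (((1 : ℚ_[p]) - (a : ℚ_[p]) * (p : ℚ_[p])⁻¹) * logOmega W p ι P)) ^ 2)) :
    IMCLowerWaldspurgerOnTreeAt p κ 𝔭 γ ι P := by
  obtain ⟨htors, f, hf, hf0, hfn⟩ := hn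
  have hmem : PowerSeries.map (R1.toCpInt p) f ∈ Ideal.span {Q} := by
    rw [hf, map_span_singleton_powerSeries] at h3
    exact (Ideal.span_singleton_le_iff_mem _).mp h3
  obtain ⟨hx0, hle⟩ := R1.two_mul_sub_one_le_valuation_int p hf0 hmem hu a h2
  refine ⟨n, ⟨htors, f, hf, hf0, hfn⟩, ?_⟩
  rw [← valuation_logOmega hx0, ← hfn]
  exact hle

end Pointwise

end Summit.BirchSwinnertonDyer.Rank1Residual.X11b

end
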